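import Literature.Topology.FourManifolds.LatticeFormsTwoHyperbolicPlanesSpecialOrthogonal
import Mathlib.LinearAlgebra.Matrix.FixedDetMatrices
import HarnessLib

/-!
# `SO⁺(U ⊕ U₁) ≅ SL₂(ℤ) × SL₂(ℤ)/{±(1₂,1₂)}` via `X ↦ B X A⁻¹`
# (Gritsenko–Hulek–Sankaran, *J. Algebra* 322 (2009) §3.2, display (14) and Lemma 3.2)

Trunk T-4MAN vocabulary. Sequel of `LatticeFormsTwoHyperbolicPlanesSpecialOrthogonal.lean` (row g49-#4: `SO⁺(H ⊕ H)` is the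
set of words in the four transvections `A_{e₀}, A_{e₁}, A'_{e₀}, A'_{e₁}` = `t(f,e₁), t(f,f₁), t(e,e₁), t(e,f₁)`). Written for
lane `lit-hodgefound` (Track 2 foundations; prover seat `lit-hodgefound-p18`, gen 49, row g49-#10). THEOREMS ONLY — no
definition, no named fact, no instance, no notation; Mathlib's `SL(2,ℤ) = Matrix.SpecialLinearGroup (Fin 2) ℤ`, `ModularGroup.S`,
`ModularGroup.T` and `SpecialLinearGroup.SL2Z_generators` (`⟨S, T⟩ = SL(2,ℤ)`) are used.

## Source, verbatim (held text `paper:arxiv-0810.1614`, p. 6, §3.2)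

"It is easy to see, using only the elementary divisor theorem, that `SL₂(ℤ) × SL₂(ℤ)/{±(1₂,1₂)} ≅ SO⁺(U ⊕ U₁)`. If we
identify `xe + x₁e₁ + y₁f₁ + yf ∈ U ⊕ U₁` with `X = (x₁ x; y −y₁)`, the isomorphism is given by **(14)**
`(B,A) ↦ (X ↦ BXA⁻¹)`. The map `X → BXA⁻¹` certainly preserves the quadratic form `−det X`. Its kernel is the centre
`±(1₂,1₂)` of `SL₂(ℤ) × SL₂(ℤ)`. The first copy of `SL₂(ℤ)` (parametrised by `B` in (14)) is generated by the transvections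
`t(e,e₁)` and `t(f,f₁)`, the second by `t(e,f₁)` and `t(f,e₁)`. […] **Lemma 3.2** `SO⁺(U ⊕ U₁)` is generated by the four
transvections `t(e,e₁)`, `t(e,f₁)`, `t(f,e₁)` and `t(f,f₁)`."

## Dictionary

`U ⊕ U₁` is `(H ⊕ H, (Fin 2 → ℤ) × (Fin 2 → ℤ))` with `e = hypX = (0,e₀)`, `f = hypY = (0,e₁)` (the outer plane) and
`e₁ = (e₀,0)`, `f₁ = (e₁,0)`; so `v = (v.1, v.2)` has `x = v.2 0`, `y = v.2 1`, `x₁ = v.1 0`, `y₁ = v.1 1` and GHS's matrix is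
`X(v) = !![v.1 0, v.2 0; v.2 1, -(v.1 1)]`, with `−det X(v) = x₁y₁ + xy = ½(v,v)`. Kirby's `A_w = t(f,w)`, `A'_w = t(e,w)`.

## Contents (all proved)

* §1 `X`: `(v,v) = −2 det X(v)`, `X` is a bijection `U ⊕ U₁ → M₂(ℤ)`; `det(BXC) = det X` for `B, C ∈ SL₂(ℤ)`.
* §2 the four generators in matrix form: `t(f,e₁) : X ↦ X·(1 0;1 1)`, `t(f,f₁) : X ↦ (1 0;−1 1)·X`, `t(e,e₁) : X ↦ (1 1;0 1)·X`,
  `t(e,f₁) : X ↦ X·(1 −1;0 1)` ("`t(e,f₁) = [(1 1;0 1)]`, `t(f,e₁) = [(1 0;−1 1)]`" on the `A`-side, `A` acting by `A⁻¹`).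
* §3 **(14) is onto**: every `φ ∈ SO⁺(U ⊕ U₁)` acts by `X ↦ B X A⁻¹` for some `B, A ∈ SL₂(ℤ)`
  (`exists_sl2_eq_of_isOrientationPreserving_of_det_eq_one`), by induction on words (Lemma 3.2).
* §4 **(14) is defined on all of `SL₂(ℤ) × SL₂(ℤ)` with values in `SO⁺`**: for all `B, A` there is a word `φ` in the four
  transvections — so `φ ∈ SO⁺(U ⊕ U₁)` — acting by `X ↦ B X A⁻¹` (`exists_isWordIn_fourTransvections_sl2`,
  `exists_specialOrthogonal_sl2`); the `B`-copy is generated by `t(e,e₁), t(f,f₁)`, the `A`-copy by `t(e,f₁), t(f,e₁)`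
  (`⟨S,T⟩ = SL₂(ℤ)` with `S = T⁻¹ (1 0;1 1) T⁻¹`).
* §5 **the kernel is `±(1₂,1₂)`** (`sl2_eq_one_or_eq_neg_one_of_forall_eq`).
-/

noncomputable section

open Module
open LinearMap (BilinForm)
open LinearMap.BilinForm
open LinearMap.BilinForm (IsometryEquiv)

namespace Literature.Topology.FourManifolds

/-! ### §1 The matrix `X(v) = (x₁ x; y −y₁)` -/

section MatrixModel

/-- The matrix `X(v) = (x₁ x; y −y₁)` is the tree's `ghsMatrix` (`LatticeFormsEichlerCriterion`) of `H ⊕ H` for the frame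
`x = hypX`, `y = hypY`, `x₁ = (e₀,0)`, `y₁ = (e₁,0)`. [cite: GritsenkoHulekSankaran2009, §3.2 ("we identify xe + x₁e₁ + y₁f₁ + yf with X")] -/
theorem ghsMatrix_hyperbolic_prod_hyperbolic (v : (Fin 2 → ℤ) × (Fin 2 → ℤ)) :
    ghsMatrix (hyperbolicForm.prod hyperbolicForm) hypX hypY (Pi.single 0 1, 0) (Pi.single 1 1, 0) v =
      !![v.1 0, v.2 0; v.2 1, -(v.1 1)] := by
  ext i j
  fin_cases i <;> fin_cases j <;> simp [ghsMatrix, prod_apply, hypX, hypY, hyperbolicForm_apply]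

/-- **`½(v,v) = x₁y₁ + xy = −det X(v)`.** [cite: GritsenkoHulekSankaran2009, §3.2 (14) ("preserves the quadratic form −det X")] -/
theorem neg_det_ghsMatrix (v : (Fin 2 → ℤ) × (Fin 2 → ℤ)) :
    -(!![v.1 0, v.2 0; v.2 1, -(v.1 1)] : Matrix (Fin 2) (Fin 2) ℤ).det = v.1 0 * v.1 1 + v.2 0 * v.2 1 := by
  rw [Matrix.det_fin_two_of]
  ring

/-- **`(v,v) = −2 det X(v)`** in `U ⊕ U₁ = H ⊕ H`. [cite: GritsenkoHulekSankaran2009, §3.2 (14)] -/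
theorem apply_self_eq_neg_two_mul_det_ghsMatrix (v : (Fin 2 → ℤ) × (Fin 2 → ℤ)) :
    (hyperbolicForm.prod hyperbolicForm) v v = -2 * (!![v.1 0, v.2 0; v.2 1, -(v.1 1)] : Matrix (Fin 2) (Fin 2) ℤ).det := by
  rw [prod_apply, hyperbolicForm_apply, hyperbolicForm_apply, Matrix.det_fin_two_of]
  ring

/-- `v ↦ X(v)` is injective. [cite: GritsenkoHulekSankaran2009, §3.2 ("we identify xe + x₁e₁ + y₁f₁ + yf with X")] -/
theorem eq_of_ghsMatrix_eq {v w : (Fin 2 → ℤ) × (Fin 2 → ℤ)}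
    (h : (!![v.1 0, v.2 0; v.2 1, -(v.1 1)] : Matrix (Fin 2) (Fin 2) ℤ) = !![w.1 0, w.2 0; w.2 1, -(w.1 1)]) : v = w := by
  have h00 := congrFun (congrFun h 0) 0
  have h01 := congrFun (congrFun h 0) 1
  have h10 := congrFun (congrFun h 1) 0
  have h11 := congrFun (congrFun h 1) 1
  simp only [Matrix.of_apply, Matrix.cons_val', Matrix.cons_val_zero, Matrix.cons_val_one, Matrix.cons_val_fin_one,
    Matrix.empty_val', neg_inj] at h00 h01 h10 h11
  refine Prod.ext (funext fun i ↦ ?_) (funext fun i ↦ ?_) <;> fin_cases i <;> assumption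

/-- `v ↦ X(v)` is surjective: `X((M₀₀, −M₁₁), (M₀₁, M₁₀)) = M`. [cite: GritsenkoHulekSankaran2009, §3.2 ("we identify … with X")] -/
theorem exists_ghsMatrix_eq (M : Matrix (Fin 2) (Fin 2) ℤ) :
    ∃ v : (Fin 2 → ℤ) × (Fin 2 → ℤ), (!![v.1 0, v.2 0; v.2 1, -(v.1 1)] : Matrix (Fin 2) (Fin 2) ℤ) = M := by
  refine ⟨(![M 0 0, -(M 1 1)], ![M 0 1, M 1 0]), ?_⟩
  rw [Matrix.eta_fin_two M]
  simp

/-- **`X ↦ B X C` preserves `−det X`** for `B, C ∈ SL₂(ℤ)`. [cite: GritsenkoHulekSankaran2009, §3.2 (14) ("certainly preserves the quadratic form −det X")] -/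
theorem det_sl2_mul_mul_sl2 (B C : Matrix.SpecialLinearGroup (Fin 2) ℤ) (M : Matrix (Fin 2) (Fin 2) ℤ) :
    ((B : Matrix (Fin 2) (Fin 2) ℤ) * M * (C : Matrix (Fin 2) (Fin 2) ℤ)).det = M.det := by
  rw [Matrix.det_mul, Matrix.det_mul, Matrix.SpecialLinearGroup.det_coe, Matrix.SpecialLinearGroup.det_coe, one_mul,
    mul_one]

end MatrixModel

/-! ### §2 The four transvections as `X ↦ BX` or `X ↦ XA⁻¹` -/

section Generators

/-- **`t(f,e₁) = A_{e₀} : X ↦ X·(1 0;1 1)`** (`= X A⁻¹` with `A = (1 0;−1 1)`: "`t(f,e₁) = [(1 0;−1 1)]`").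
[cite: GritsenkoHulekSankaran2009, §3.2 (12), (14)] -/
theorem ghsMatrix_transvectionAEquiv_e₀ (v : (Fin 2 → ℤ) × (Fin 2 → ℤ)) :
    (!![(transvectionAEquiv isSymm_hyperbolicForm (Pi.single 0 1) 0 hyperbolicPlane_apply_e₀_e₀ v).1 0,
        (transvectionAEquiv isSymm_hyperbolicForm (Pi.single 0 1) 0 hyperbolicPlane_apply_e₀_e₀ v).2 0;
        (transvectionAEquiv isSymm_hyperbolicForm (Pi.single 0 1) 0 hyperbolicPlane_apply_e₀_e₀ v).2 1,
        -((transvectionAEquiv isSymm_hyperbolicForm (Pi.single 0 1) 0 hyperbolicPlane_apply_e₀_e₀ v).1 1)] :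
        Matrix (Fin 2) (Fin 2) ℤ) =
      !![v.1 0, v.2 0; v.2 1, -(v.1 1)] * !![1, 0; 1, 1] := by
  rw [Matrix.mul_fin_two]
  ext i j
  fin_cases i <;> fin_cases j <;> simp [transvectionA, hyperbolicForm_apply]
  ring

/-- **`t(f,f₁) = A_{e₁} : X ↦ (1 0;−1 1)·X`.** [cite: GritsenkoHulekSankaran2009, §3.2 (14) ("the first copy … generated by t(e,e₁) and t(f,f₁)")] -/
theorem ghsMatrix_transvectionAEquiv_e₁ (v : (Fin 2 → ℤ) × (Fin 2 → ℤ)) :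
    (!![(transvectionAEquiv isSymm_hyperbolicForm (Pi.single 1 1) 0 hyperbolicPlane_apply_e₁_e₁ v).1 0,
        (transvectionAEquiv isSymm_hyperbolicForm (Pi.single 1 1) 0 hyperbolicPlane_apply_e₁_e₁ v).2 0;
        (transvectionAEquiv isSymm_hyperbolicForm (Pi.single 1 1) 0 hyperbolicPlane_apply_e₁_e₁ v).2 1,
        -((transvectionAEquiv isSymm_hyperbolicForm (Pi.single 1 1) 0 hyperbolicPlane_apply_e₁_e₁ v).1 1)] :
        Matrix (Fin 2) (Fin 2) ℤ) =
      !![1, 0; -1, 1] * !![v.1 0, v.2 0; v.2 1, -(v.1 1)] := by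
  rw [Matrix.mul_fin_two]
  ext i j
  fin_cases i <;> fin_cases j <;> simp [transvectionA, hyperbolicForm_apply]
  ring

/-- **`t(e,e₁) = A'_{e₀} : X ↦ (1 1;0 1)·X`.** [cite: GritsenkoHulekSankaran2009, §3.2 (14) ("the first copy … generated by t(e,e₁) and t(f,f₁)")] -/
theorem ghsMatrix_transvectionA'Equiv_e₀ (v : (Fin 2 → ℤ) × (Fin 2 → ℤ)) :
    (!![(transvectionA'Equiv isSymm_hyperbolicForm (Pi.single 0 1) 0 hyperbolicPlane_apply_e₀_e₀ v).1 0,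
        (transvectionA'Equiv isSymm_hyperbolicForm (Pi.single 0 1) 0 hyperbolicPlane_apply_e₀_e₀ v).2 0;
        (transvectionA'Equiv isSymm_hyperbolicForm (Pi.single 0 1) 0 hyperbolicPlane_apply_e₀_e₀ v).2 1,
        -((transvectionA'Equiv isSymm_hyperbolicForm (Pi.single 0 1) 0 hyperbolicPlane_apply_e₀_e₀ v).1 1)] :
        Matrix (Fin 2) (Fin 2) ℤ) =
      !![1, 1; 0, 1] * !![v.1 0, v.2 0; v.2 1, -(v.1 1)] := by
  rw [Matrix.mul_fin_two]
  ext i j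
  fin_cases i <;> fin_cases j <;> simp [transvectionA', hyperbolicForm_apply]
  ring

/-- **`t(e,f₁) = A'_{e₁} : X ↦ X·(1 −1;0 1)`** (`= X A⁻¹` with `A = (1 1;0 1)`: "`t(e,f₁) = [(1 1;0 1)]`").
[cite: GritsenkoHulekSankaran2009, §3.2 (12), (14)] -/
theorem ghsMatrix_transvectionA'Equiv_e₁ (v : (Fin 2 → ℤ) × (Fin 2 → ℤ)) :
    (!![(transvectionA'Equiv isSymm_hyperbolicForm (Pi.single 1 1) 0 hyperbolicPlane_apply_e₁_e₁ v).1 0,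
        (transvectionA'Equiv isSymm_hyperbolicForm (Pi.single 1 1) 0 hyperbolicPlane_apply_e₁_e₁ v).2 0;
        (transvectionA'Equiv isSymm_hyperbolicForm (Pi.single 1 1) 0 hyperbolicPlane_apply_e₁_e₁ v).2 1,
        -((transvectionA'Equiv isSymm_hyperbolicForm (Pi.single 1 1) 0 hyperbolicPlane_apply_e₁_e₁ v).1 1)] :
        Matrix (Fin 2) (Fin 2) ℤ) =
      !![v.1 0, v.2 0; v.2 1, -(v.1 1)] * !![1, -1; 0, 1] := by
  rw [Matrix.mul_fin_two]
  ext i j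
  fin_cases i <;> fin_cases j <;> simp [transvectionA', hyperbolicForm_apply]
  ring

end Generators

/-! ### §3 (14) is onto `SO⁺(U ⊕ U₁)` -/

section Onto

/-- The relation "`φ` acts by `X ↦ B X C`, `B, C ∈ SL₂(ℤ)`" holds for the identity. [cite: GritsenkoHulekSankaran2009, §3.2 (14)] -/
theorem exists_sl2_ghsMatrix_refl :
    ∃ B C : Matrix.SpecialLinearGroup (Fin 2) ℤ, ∀ v : (Fin 2 → ℤ) × (Fin 2 → ℤ),
      (!![((LinearMap.BilinForm.IsometryEquiv.refl (hyperbolicForm.prod hyperbolicForm)) v).1 0,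
          ((LinearMap.BilinForm.IsometryEquiv.refl (hyperbolicForm.prod hyperbolicForm)) v).2 0;
          ((LinearMap.BilinForm.IsometryEquiv.refl (hyperbolicForm.prod hyperbolicForm)) v).2 1,
          -(((LinearMap.BilinForm.IsometryEquiv.refl (hyperbolicForm.prod hyperbolicForm)) v).1 1)] :
          Matrix (Fin 2) (Fin 2) ℤ) =
        (B : Matrix (Fin 2) (Fin 2) ℤ) * !![v.1 0, v.2 0; v.2 1, -(v.1 1)] * (C : Matrix (Fin 2) (Fin 2) ℤ) :=
  ⟨1, 1, fun v ↦ by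
    rw [Matrix.SpecialLinearGroup.coe_one, one_mul, mul_one, LinearMap.BilinForm.IsometryEquiv.refl_apply]⟩

/-- The relation "`φ` acts by `X ↦ B X C`" is closed under composition (`(B,C)·(B',C') = (B'B, CC')`).
[cite: GritsenkoHulekSankaran2009, §3.2 (14) ("the isomorphism is given by (B,A) ↦ (X ↦ BXA⁻¹)")] -/
theorem exists_sl2_ghsMatrix_trans {φ χ : (hyperbolicForm.prod hyperbolicForm).IsometryEquiv (hyperbolicForm.prod hyperbolicForm)}
    (hφ : ∃ B C : Matrix.SpecialLinearGroup (Fin 2) ℤ, ∀ v : (Fin 2 → ℤ) × (Fin 2 → ℤ),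
      (!![(φ v).1 0, (φ v).2 0; (φ v).2 1, -((φ v).1 1)] : Matrix (Fin 2) (Fin 2) ℤ) =
        (B : Matrix (Fin 2) (Fin 2) ℤ) * !![v.1 0, v.2 0; v.2 1, -(v.1 1)] * (C : Matrix (Fin 2) (Fin 2) ℤ))
    (hχ : ∃ B C : Matrix.SpecialLinearGroup (Fin 2) ℤ, ∀ v : (Fin 2 → ℤ) × (Fin 2 → ℤ),
      (!![(χ v).1 0, (χ v).2 0; (χ v).2 1, -((χ v).1 1)] : Matrix (Fin 2) (Fin 2) ℤ) =
        (B : Matrix (Fin 2) (Fin 2) ℤ) * !![v.1 0, v.2 0; v.2 1, -(v.1 1)] * (C : Matrix (Fin 2) (Fin 2) ℤ)) :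
    ∃ B C : Matrix.SpecialLinearGroup (Fin 2) ℤ, ∀ v : (Fin 2 → ℤ) × (Fin 2 → ℤ),
      (!![((φ.trans χ) v).1 0, ((φ.trans χ) v).2 0; ((φ.trans χ) v).2 1, -(((φ.trans χ) v).1 1)] :
          Matrix (Fin 2) (Fin 2) ℤ) =
        (B : Matrix (Fin 2) (Fin 2) ℤ) * !![v.1 0, v.2 0; v.2 1, -(v.1 1)] * (C : Matrix (Fin 2) (Fin 2) ℤ) := by
  obtain ⟨B, C, hφ⟩ := hφ
  obtain ⟨B', C', hχ⟩ := hχ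
  refine ⟨B' * B, C * C', fun v ↦ ?_⟩
  rw [LinearMap.BilinForm.IsometryEquiv.trans_apply, hχ, hφ, Matrix.SpecialLinearGroup.coe_mul,
    Matrix.SpecialLinearGroup.coe_mul]
  simp only [Matrix.mul_assoc]

/-- The relation "`φ` acts by `X ↦ B X C`" passes to inverses (`(B,C) ↦ (B⁻¹, C⁻¹)`). [cite: GritsenkoHulekSankaran2009, §3.2 (14)] -/
theorem exists_sl2_ghsMatrix_symm {φ : (hyperbolicForm.prod hyperbolicForm).IsometryEquiv (hyperbolicForm.prod hyperbolicForm)}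
    (hφ : ∃ B C : Matrix.SpecialLinearGroup (Fin 2) ℤ, ∀ v : (Fin 2 → ℤ) × (Fin 2 → ℤ),
      (!![(φ v).1 0, (φ v).2 0; (φ v).2 1, -((φ v).1 1)] : Matrix (Fin 2) (Fin 2) ℤ) =
        (B : Matrix (Fin 2) (Fin 2) ℤ) * !![v.1 0, v.2 0; v.2 1, -(v.1 1)] * (C : Matrix (Fin 2) (Fin 2) ℤ)) :
    ∃ B C : Matrix.SpecialLinearGroup (Fin 2) ℤ, ∀ v : (Fin 2 → ℤ) × (Fin 2 → ℤ),
      (!![(φ.symm v).1 0, (φ.symm v).2 0; (φ.symm v).2 1, -((φ.symm v).1 1)] : Matrix (Fin 2) (Fin 2) ℤ) =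
        (B : Matrix (Fin 2) (Fin 2) ℤ) * !![v.1 0, v.2 0; v.2 1, -(v.1 1)] * (C : Matrix (Fin 2) (Fin 2) ℤ) := by
  obtain ⟨B, C, hφ⟩ := hφ
  refine ⟨B⁻¹, C⁻¹, fun v ↦ ?_⟩
  have key := hφ (φ.symm v)
  rw [LinearMap.BilinForm.IsometryEquiv.apply_symm_apply] at key
  have hB : ((B⁻¹ : Matrix.SpecialLinearGroup (Fin 2) ℤ) : Matrix (Fin 2) (Fin 2) ℤ) * (B : Matrix (Fin 2) (Fin 2) ℤ) = 1 := by
    rw [← Matrix.SpecialLinearGroup.coe_mul, inv_mul_cancel, Matrix.SpecialLinearGroup.coe_one]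
  have hC : (C : Matrix (Fin 2) (Fin 2) ℤ) * ((C⁻¹ : Matrix.SpecialLinearGroup (Fin 2) ℤ) : Matrix (Fin 2) (Fin 2) ℤ) = 1 := by
    rw [← Matrix.SpecialLinearGroup.coe_mul, mul_inv_cancel, Matrix.SpecialLinearGroup.coe_one]
  rw [key]
  calc (!![(φ.symm v).1 0, (φ.symm v).2 0; (φ.symm v).2 1, -((φ.symm v).1 1)] : Matrix (Fin 2) (Fin 2) ℤ)
      = (((B⁻¹ : Matrix.SpecialLinearGroup (Fin 2) ℤ) : Matrix (Fin 2) (Fin 2) ℤ) * (B : Matrix (Fin 2) (Fin 2) ℤ)) *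
          !![(φ.symm v).1 0, (φ.symm v).2 0; (φ.symm v).2 1, -((φ.symm v).1 1)] *
          ((C : Matrix (Fin 2) (Fin 2) ℤ) * ((C⁻¹ : Matrix.SpecialLinearGroup (Fin 2) ℤ) : Matrix (Fin 2) (Fin 2) ℤ)) := by
        rw [hB, hC, one_mul, mul_one]
    _ = _ := by simp only [Matrix.mul_assoc]

/-- Each of the four generating transvections acts by `X ↦ B X C` with `(B, C)` unipotent.
[cite: GritsenkoHulekSankaran2009, §3.2 (12), (14)] -/
theorem exists_sl2_ghsMatrix_of_mem_fourTransvections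
    {φ : (hyperbolicForm.prod hyperbolicForm).IsometryEquiv (hyperbolicForm.prod hyperbolicForm)}
    (hφ : φ ∈ ({transvectionAEquiv isSymm_hyperbolicForm (Pi.single 0 1) 0 hyperbolicPlane_apply_e₀_e₀,
        transvectionAEquiv isSymm_hyperbolicForm (Pi.single 1 1) 0 hyperbolicPlane_apply_e₁_e₁,
        transvectionA'Equiv isSymm_hyperbolicForm (Pi.single 0 1) 0 hyperbolicPlane_apply_e₀_e₀,
        transvectionA'Equiv isSymm_hyperbolicForm (Pi.single 1 1) 0 hyperbolicPlane_apply_e₁_e₁} :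
        Set ((hyperbolicForm.prod hyperbolicForm).IsometryEquiv (hyperbolicForm.prod hyperbolicForm)))) :
    ∃ B C : Matrix.SpecialLinearGroup (Fin 2) ℤ, ∀ v : (Fin 2 → ℤ) × (Fin 2 → ℤ),
      (!![(φ v).1 0, (φ v).2 0; (φ v).2 1, -((φ v).1 1)] : Matrix (Fin 2) (Fin 2) ℤ) =
        (B : Matrix (Fin 2) (Fin 2) ℤ) * !![v.1 0, v.2 0; v.2 1, -(v.1 1)] * (C : Matrix (Fin 2) (Fin 2) ℤ) := by
  rcases hφ with rfl | rfl | rfl | rfl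
  · exact ⟨1, ⟨!![1, 0; 1, 1], by norm_num [Matrix.det_fin_two_of]⟩, fun v ↦ by
      rw [Matrix.SpecialLinearGroup.coe_one, one_mul, ghsMatrix_transvectionAEquiv_e₀]⟩
  · exact ⟨⟨!![1, 0; -1, 1], by norm_num [Matrix.det_fin_two_of]⟩, 1, fun v ↦ by
      rw [Matrix.SpecialLinearGroup.coe_one, mul_one, ghsMatrix_transvectionAEquiv_e₁]⟩
  · exact ⟨⟨!![1, 1; 0, 1], by norm_num [Matrix.det_fin_two_of]⟩, 1, fun v ↦ by
      rw [Matrix.SpecialLinearGroup.coe_one, mul_one, ghsMatrix_transvectionA'Equiv_e₀]⟩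
  · exact ⟨1, ⟨!![1, -1; 0, 1], by norm_num [Matrix.det_fin_two_of]⟩, fun v ↦ by
      rw [Matrix.SpecialLinearGroup.coe_one, one_mul, ghsMatrix_transvectionA'Equiv_e₁]⟩

/-- Every word in the four transvections acts by `X ↦ B X C`, `B, C ∈ SL₂(ℤ)`. [cite: GritsenkoHulekSankaran2009, §3.2 (14) and Lemma 3.2] -/
theorem exists_sl2_ghsMatrix_of_isWordIn_fourTransvections
    {φ : (hyperbolicForm.prod hyperbolicForm).IsometryEquiv (hyperbolicForm.prod hyperbolicForm)}
    (hφ : IsWordIn {transvectionAEquiv isSymm_hyperbolicForm (Pi.single 0 1) 0 hyperbolicPlane_apply_e₀_e₀,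
        transvectionAEquiv isSymm_hyperbolicForm (Pi.single 1 1) 0 hyperbolicPlane_apply_e₁_e₁,
        transvectionA'Equiv isSymm_hyperbolicForm (Pi.single 0 1) 0 hyperbolicPlane_apply_e₀_e₀,
        transvectionA'Equiv isSymm_hyperbolicForm (Pi.single 1 1) 0 hyperbolicPlane_apply_e₁_e₁} φ) :
    ∃ B C : Matrix.SpecialLinearGroup (Fin 2) ℤ, ∀ v : (Fin 2 → ℤ) × (Fin 2 → ℤ),
      (!![(φ v).1 0, (φ v).2 0; (φ v).2 1, -((φ v).1 1)] : Matrix (Fin 2) (Fin 2) ℤ) =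
        (B : Matrix (Fin 2) (Fin 2) ℤ) * !![v.1 0, v.2 0; v.2 1, -(v.1 1)] * (C : Matrix (Fin 2) (Fin 2) ℤ) :=
  hφ.induction_on (P := fun ψ ↦ ∃ B C : Matrix.SpecialLinearGroup (Fin 2) ℤ, ∀ v : (Fin 2 → ℤ) × (Fin 2 → ℤ),
      (!![(ψ v).1 0, (ψ v).2 0; (ψ v).2 1, -((ψ v).1 1)] : Matrix (Fin 2) (Fin 2) ℤ) =
        (B : Matrix (Fin 2) (Fin 2) ℤ) * !![v.1 0, v.2 0; v.2 1, -(v.1 1)] * (C : Matrix (Fin 2) (Fin 2) ℤ))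
    (fun _ hs ↦ exists_sl2_ghsMatrix_of_mem_fourTransvections hs) exists_sl2_ghsMatrix_refl
    (fun _ _ hψ hχ ↦ exists_sl2_ghsMatrix_trans hψ hχ) fun _ hψ ↦ exists_sl2_ghsMatrix_symm hψ

/-- **(14) is onto: every `φ ∈ SO⁺(U ⊕ U₁)` is `X ↦ B X A⁻¹` for some `(B, A) ∈ SL₂(ℤ) × SL₂(ℤ)`.**
[cite: GritsenkoHulekSankaran2009, §3.2 (14) and Lemma 3.2] -/
theorem exists_sl2_eq_of_isOrientationPreserving_of_det_eq_one
    (φ : (hyperbolicForm.prod hyperbolicForm).IsometryEquiv (hyperbolicForm.prod hyperbolicForm))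
    (h₁ : φ.IsOrientationPreserving)
    (h₂ : LinearMap.det (φ : (Fin 2 → ℤ) × (Fin 2 → ℤ) →ₗ[ℤ] (Fin 2 → ℤ) × (Fin 2 → ℤ)) = 1) :
    ∃ B A : Matrix.SpecialLinearGroup (Fin 2) ℤ, ∀ v : (Fin 2 → ℤ) × (Fin 2 → ℤ),
      (!![(φ v).1 0, (φ v).2 0; (φ v).2 1, -((φ v).1 1)] : Matrix (Fin 2) (Fin 2) ℤ) =
        (B : Matrix (Fin 2) (Fin 2) ℤ) * !![v.1 0, v.2 0; v.2 1, -(v.1 1)] *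
          ((A⁻¹ : Matrix.SpecialLinearGroup (Fin 2) ℤ) : Matrix (Fin 2) (Fin 2) ℤ) := by
  obtain ⟨B, C, h⟩ := exists_sl2_ghsMatrix_of_isWordIn_fourTransvections ((isWordIn_fourTransvections_iff φ).2 ⟨h₁, h₂⟩)
  exact ⟨B, C⁻¹, fun v ↦ by rw [inv_inv]; exact h v⟩

end Onto

/-! ### §4 (14) is defined on all of `SL₂(ℤ) × SL₂(ℤ)`, with values in `SO⁺(U ⊕ U₁)` -/

section Realisation

/-- `B`-side closure under products: realisations `X ↦ BX`, `X ↦ B'X` by words give one of `X ↦ (BB')X`.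
[cite: GritsenkoHulekSankaran2009, §3.2 (14) ("The first copy of SL₂(ℤ) (parametrised by B)")] -/
theorem exists_isWordIn_fourTransvections_left_mul {B B' : Matrix.SpecialLinearGroup (Fin 2) ℤ}
    (hB : ∃ φ : (hyperbolicForm.prod hyperbolicForm).IsometryEquiv (hyperbolicForm.prod hyperbolicForm),
      IsWordIn {transvectionAEquiv isSymm_hyperbolicForm (Pi.single 0 1) 0 hyperbolicPlane_apply_e₀_e₀,
        transvectionAEquiv isSymm_hyperbolicForm (Pi.single 1 1) 0 hyperbolicPlane_apply_e₁_e₁,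
        transvectionA'Equiv isSymm_hyperbolicForm (Pi.single 0 1) 0 hyperbolicPlane_apply_e₀_e₀,
        transvectionA'Equiv isSymm_hyperbolicForm (Pi.single 1 1) 0 hyperbolicPlane_apply_e₁_e₁} φ ∧
      ∀ v : (Fin 2 → ℤ) × (Fin 2 → ℤ), (!![(φ v).1 0, (φ v).2 0; (φ v).2 1, -((φ v).1 1)] : Matrix (Fin 2) (Fin 2) ℤ) =
        (B : Matrix (Fin 2) (Fin 2) ℤ) * !![v.1 0, v.2 0; v.2 1, -(v.1 1)])
    (hB' : ∃ φ : (hyperbolicForm.prod hyperbolicForm).IsometryEquiv (hyperbolicForm.prod hyperbolicForm),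
      IsWordIn {transvectionAEquiv isSymm_hyperbolicForm (Pi.single 0 1) 0 hyperbolicPlane_apply_e₀_e₀,
        transvectionAEquiv isSymm_hyperbolicForm (Pi.single 1 1) 0 hyperbolicPlane_apply_e₁_e₁,
        transvectionA'Equiv isSymm_hyperbolicForm (Pi.single 0 1) 0 hyperbolicPlane_apply_e₀_e₀,
        transvectionA'Equiv isSymm_hyperbolicForm (Pi.single 1 1) 0 hyperbolicPlane_apply_e₁_e₁} φ ∧
      ∀ v : (Fin 2 → ℤ) × (Fin 2 → ℤ), (!![(φ v).1 0, (φ v).2 0; (φ v).2 1, -((φ v).1 1)] : Matrix (Fin 2) (Fin 2) ℤ) =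
        (B' : Matrix (Fin 2) (Fin 2) ℤ) * !![v.1 0, v.2 0; v.2 1, -(v.1 1)]) :
    ∃ φ : (hyperbolicForm.prod hyperbolicForm).IsometryEquiv (hyperbolicForm.prod hyperbolicForm),
      IsWordIn {transvectionAEquiv isSymm_hyperbolicForm (Pi.single 0 1) 0 hyperbolicPlane_apply_e₀_e₀,
        transvectionAEquiv isSymm_hyperbolicForm (Pi.single 1 1) 0 hyperbolicPlane_apply_e₁_e₁,
        transvectionA'Equiv isSymm_hyperbolicForm (Pi.single 0 1) 0 hyperbolicPlane_apply_e₀_e₀,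
        transvectionA'Equiv isSymm_hyperbolicForm (Pi.single 1 1) 0 hyperbolicPlane_apply_e₁_e₁} φ ∧
      ∀ v : (Fin 2 → ℤ) × (Fin 2 → ℤ), (!![(φ v).1 0, (φ v).2 0; (φ v).2 1, -((φ v).1 1)] : Matrix (Fin 2) (Fin 2) ℤ) =
        ((B * B' : Matrix.SpecialLinearGroup (Fin 2) ℤ) : Matrix (Fin 2) (Fin 2) ℤ) * !![v.1 0, v.2 0; v.2 1, -(v.1 1)] := by
  obtain ⟨φ, hφw, hφ⟩ := hB
  obtain ⟨φ', hφ'w, hφ'⟩ := hB'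
  refine ⟨φ'.trans φ, hφ'w.trans hφw, fun v ↦ ?_⟩
  rw [LinearMap.BilinForm.IsometryEquiv.trans_apply, hφ, hφ', Matrix.SpecialLinearGroup.coe_mul, Matrix.mul_assoc]

/-- `B`-side closure under inverses. [cite: GritsenkoHulekSankaran2009, §3.2 (14)] -/
theorem exists_isWordIn_fourTransvections_left_inv {B : Matrix.SpecialLinearGroup (Fin 2) ℤ}
    (hB : ∃ φ : (hyperbolicForm.prod hyperbolicForm).IsometryEquiv (hyperbolicForm.prod hyperbolicForm),
      IsWordIn {transvectionAEquiv isSymm_hyperbolicForm (Pi.single 0 1) 0 hyperbolicPlane_apply_e₀_e₀,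
        transvectionAEquiv isSymm_hyperbolicForm (Pi.single 1 1) 0 hyperbolicPlane_apply_e₁_e₁,
        transvectionA'Equiv isSymm_hyperbolicForm (Pi.single 0 1) 0 hyperbolicPlane_apply_e₀_e₀,
        transvectionA'Equiv isSymm_hyperbolicForm (Pi.single 1 1) 0 hyperbolicPlane_apply_e₁_e₁} φ ∧
      ∀ v : (Fin 2 → ℤ) × (Fin 2 → ℤ), (!![(φ v).1 0, (φ v).2 0; (φ v).2 1, -((φ v).1 1)] : Matrix (Fin 2) (Fin 2) ℤ) =
        (B : Matrix (Fin 2) (Fin 2) ℤ) * !![v.1 0, v.2 0; v.2 1, -(v.1 1)]) :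
    ∃ φ : (hyperbolicForm.prod hyperbolicForm).IsometryEquiv (hyperbolicForm.prod hyperbolicForm),
      IsWordIn {transvectionAEquiv isSymm_hyperbolicForm (Pi.single 0 1) 0 hyperbolicPlane_apply_e₀_e₀,
        transvectionAEquiv isSymm_hyperbolicForm (Pi.single 1 1) 0 hyperbolicPlane_apply_e₁_e₁,
        transvectionA'Equiv isSymm_hyperbolicForm (Pi.single 0 1) 0 hyperbolicPlane_apply_e₀_e₀,
        transvectionA'Equiv isSymm_hyperbolicForm (Pi.single 1 1) 0 hyperbolicPlane_apply_e₁_e₁} φ ∧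
      ∀ v : (Fin 2 → ℤ) × (Fin 2 → ℤ), (!![(φ v).1 0, (φ v).2 0; (φ v).2 1, -((φ v).1 1)] : Matrix (Fin 2) (Fin 2) ℤ) =
        ((B⁻¹ : Matrix.SpecialLinearGroup (Fin 2) ℤ) : Matrix (Fin 2) (Fin 2) ℤ) * !![v.1 0, v.2 0; v.2 1, -(v.1 1)] := by
  obtain ⟨φ, hφw, hφ⟩ := hB
  refine ⟨φ.symm, hφw.symm, fun v ↦ ?_⟩
  have key := hφ (φ.symm v)
  rw [LinearMap.BilinForm.IsometryEquiv.apply_symm_apply] at key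
  have hB : ((B⁻¹ : Matrix.SpecialLinearGroup (Fin 2) ℤ) : Matrix (Fin 2) (Fin 2) ℤ) * (B : Matrix (Fin 2) (Fin 2) ℤ) = 1 := by
    rw [← Matrix.SpecialLinearGroup.coe_mul, inv_mul_cancel, Matrix.SpecialLinearGroup.coe_one]
  rw [key, ← Matrix.mul_assoc, hB, one_mul]

/-- `A`-side closure under products: realisations `X ↦ XC`, `X ↦ XC'` by words give one of `X ↦ X(CC')`.
[cite: GritsenkoHulekSankaran2009, §3.2 (14) ("the second by t(e,f₁) and t(f,e₁)")] -/
theorem exists_isWordIn_fourTransvections_right_mul {C C' : Matrix.SpecialLinearGroup (Fin 2) ℤ}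
    (hC : ∃ φ : (hyperbolicForm.prod hyperbolicForm).IsometryEquiv (hyperbolicForm.prod hyperbolicForm),
      IsWordIn {transvectionAEquiv isSymm_hyperbolicForm (Pi.single 0 1) 0 hyperbolicPlane_apply_e₀_e₀,
        transvectionAEquiv isSymm_hyperbolicForm (Pi.single 1 1) 0 hyperbolicPlane_apply_e₁_e₁,
        transvectionA'Equiv isSymm_hyperbolicForm (Pi.single 0 1) 0 hyperbolicPlane_apply_e₀_e₀,
        transvectionA'Equiv isSymm_hyperbolicForm (Pi.single 1 1) 0 hyperbolicPlane_apply_e₁_e₁} φ ∧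
      ∀ v : (Fin 2 → ℤ) × (Fin 2 → ℤ), (!![(φ v).1 0, (φ v).2 0; (φ v).2 1, -((φ v).1 1)] : Matrix (Fin 2) (Fin 2) ℤ) =
        !![v.1 0, v.2 0; v.2 1, -(v.1 1)] * (C : Matrix (Fin 2) (Fin 2) ℤ))
    (hC' : ∃ φ : (hyperbolicForm.prod hyperbolicForm).IsometryEquiv (hyperbolicForm.prod hyperbolicForm),
      IsWordIn {transvectionAEquiv isSymm_hyperbolicForm (Pi.single 0 1) 0 hyperbolicPlane_apply_e₀_e₀,
        transvectionAEquiv isSymm_hyperbolicForm (Pi.single 1 1) 0 hyperbolicPlane_apply_e₁_e₁,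
        transvectionA'Equiv isSymm_hyperbolicForm (Pi.single 0 1) 0 hyperbolicPlane_apply_e₀_e₀,
        transvectionA'Equiv isSymm_hyperbolicForm (Pi.single 1 1) 0 hyperbolicPlane_apply_e₁_e₁} φ ∧
      ∀ v : (Fin 2 → ℤ) × (Fin 2 → ℤ), (!![(φ v).1 0, (φ v).2 0; (φ v).2 1, -((φ v).1 1)] : Matrix (Fin 2) (Fin 2) ℤ) =
        !![v.1 0, v.2 0; v.2 1, -(v.1 1)] * (C' : Matrix (Fin 2) (Fin 2) ℤ)) :
    ∃ φ : (hyperbolicForm.prod hyperbolicForm).IsometryEquiv (hyperbolicForm.prod hyperbolicForm),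
      IsWordIn {transvectionAEquiv isSymm_hyperbolicForm (Pi.single 0 1) 0 hyperbolicPlane_apply_e₀_e₀,
        transvectionAEquiv isSymm_hyperbolicForm (Pi.single 1 1) 0 hyperbolicPlane_apply_e₁_e₁,
        transvectionA'Equiv isSymm_hyperbolicForm (Pi.single 0 1) 0 hyperbolicPlane_apply_e₀_e₀,
        transvectionA'Equiv isSymm_hyperbolicForm (Pi.single 1 1) 0 hyperbolicPlane_apply_e₁_e₁} φ ∧
      ∀ v : (Fin 2 → ℤ) × (Fin 2 → ℤ), (!![(φ v).1 0, (φ v).2 0; (φ v).2 1, -((φ v).1 1)] : Matrix (Fin 2) (Fin 2) ℤ) =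
        !![v.1 0, v.2 0; v.2 1, -(v.1 1)] * ((C * C' : Matrix.SpecialLinearGroup (Fin 2) ℤ) : Matrix (Fin 2) (Fin 2) ℤ) := by
  obtain ⟨φ, hφw, hφ⟩ := hC
  obtain ⟨φ', hφ'w, hφ'⟩ := hC'
  refine ⟨φ.trans φ', hφw.trans hφ'w, fun v ↦ ?_⟩
  rw [LinearMap.BilinForm.IsometryEquiv.trans_apply, hφ', hφ, Matrix.SpecialLinearGroup.coe_mul, Matrix.mul_assoc]

/-- `A`-side closure under inverses. [cite: GritsenkoHulekSankaran2009, §3.2 (14)] -/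
theorem exists_isWordIn_fourTransvections_right_inv {C : Matrix.SpecialLinearGroup (Fin 2) ℤ}
    (hC : ∃ φ : (hyperbolicForm.prod hyperbolicForm).IsometryEquiv (hyperbolicForm.prod hyperbolicForm),
      IsWordIn {transvectionAEquiv isSymm_hyperbolicForm (Pi.single 0 1) 0 hyperbolicPlane_apply_e₀_e₀,
        transvectionAEquiv isSymm_hyperbolicForm (Pi.single 1 1) 0 hyperbolicPlane_apply_e₁_e₁,
        transvectionA'Equiv isSymm_hyperbolicForm (Pi.single 0 1) 0 hyperbolicPlane_apply_e₀_e₀,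
        transvectionA'Equiv isSymm_hyperbolicForm (Pi.single 1 1) 0 hyperbolicPlane_apply_e₁_e₁} φ ∧
      ∀ v : (Fin 2 → ℤ) × (Fin 2 → ℤ), (!![(φ v).1 0, (φ v).2 0; (φ v).2 1, -((φ v).1 1)] : Matrix (Fin 2) (Fin 2) ℤ) =
        !![v.1 0, v.2 0; v.2 1, -(v.1 1)] * (C : Matrix (Fin 2) (Fin 2) ℤ)) :
    ∃ φ : (hyperbolicForm.prod hyperbolicForm).IsometryEquiv (hyperbolicForm.prod hyperbolicForm),
      IsWordIn {transvectionAEquiv isSymm_hyperbolicForm (Pi.single 0 1) 0 hyperbolicPlane_apply_e₀_e₀,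
        transvectionAEquiv isSymm_hyperbolicForm (Pi.single 1 1) 0 hyperbolicPlane_apply_e₁_e₁,
        transvectionA'Equiv isSymm_hyperbolicForm (Pi.single 0 1) 0 hyperbolicPlane_apply_e₀_e₀,
        transvectionA'Equiv isSymm_hyperbolicForm (Pi.single 1 1) 0 hyperbolicPlane_apply_e₁_e₁} φ ∧
      ∀ v : (Fin 2 → ℤ) × (Fin 2 → ℤ), (!![(φ v).1 0, (φ v).2 0; (φ v).2 1, -((φ v).1 1)] : Matrix (Fin 2) (Fin 2) ℤ) =
        !![v.1 0, v.2 0; v.2 1, -(v.1 1)] * ((C⁻¹ : Matrix.SpecialLinearGroup (Fin 2) ℤ) : Matrix (Fin 2) (Fin 2) ℤ) := by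
  obtain ⟨φ, hφw, hφ⟩ := hC
  refine ⟨φ.symm, hφw.symm, fun v ↦ ?_⟩
  have key := hφ (φ.symm v)
  rw [LinearMap.BilinForm.IsometryEquiv.apply_symm_apply] at key
  have hC : (C : Matrix (Fin 2) (Fin 2) ℤ) * ((C⁻¹ : Matrix.SpecialLinearGroup (Fin 2) ℤ) : Matrix (Fin 2) (Fin 2) ℤ) = 1 := by
    rw [← Matrix.SpecialLinearGroup.coe_mul, mul_inv_cancel, Matrix.SpecialLinearGroup.coe_one]
  rw [key, Matrix.mul_assoc, hC, mul_one]

/-- `S = T⁻¹ · (1 0;1 1) · T⁻¹` in `SL₂(ℤ)` (the unipotent generation behind "elementary divisor theorem").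
[cite: GritsenkoHulekSankaran2009, §3.2 ("using only the elementary divisor theorem")] -/
theorem modularGroup_S_eq :
    ModularGroup.S = ModularGroup.T⁻¹ * ⟨!![1, 0; 1, 1], by norm_num [Matrix.det_fin_two_of]⟩ * ModularGroup.T⁻¹ := by
  refine Subtype.ext ?_
  rw [Matrix.SpecialLinearGroup.coe_mul, Matrix.SpecialLinearGroup.coe_mul, ModularGroup.coe_T_inv, ModularGroup.coe_S,
    Matrix.mul_fin_two, Matrix.mul_fin_two]
  norm_num

/-- `S = T⁻¹ · U⁻¹ · T⁻¹` for `U = (1 0;−1 1)` in `SL₂(ℤ)`. [cite: GritsenkoHulekSankaran2009, §3.2 ("using only the elementary divisor theorem")] -/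
theorem modularGroup_S_eq_inv (U : Matrix.SpecialLinearGroup (Fin 2) ℤ) (hU : (U : Matrix (Fin 2) (Fin 2) ℤ) = !![1, 0; -1, 1]) :
    ModularGroup.S = ModularGroup.T⁻¹ * U⁻¹ * ModularGroup.T⁻¹ := by
  refine Subtype.ext ?_
  rw [Matrix.SpecialLinearGroup.coe_mul, Matrix.SpecialLinearGroup.coe_mul, ModularGroup.coe_T_inv, ModularGroup.coe_S,
    Matrix.SpecialLinearGroup.coe_inv, hU, Matrix.adjugate_fin_two_of, Matrix.mul_fin_two, Matrix.mul_fin_two]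
  norm_num

/-- **The `B`-copy of `SL₂(ℤ)` is realised by words** (generated by `t(e,e₁) : X ↦ (1 1;0 1)X` and `t(f,f₁) : X ↦ (1 0;−1 1)X`):
for every `B ∈ SL₂(ℤ)` some word `φ` in the four transvections acts by `X ↦ BX`.
[cite: GritsenkoHulekSankaran2009, §3.2 (14) ("The first copy of SL₂(ℤ) … is generated by the transvections t(e,e₁) and t(f,f₁)")] -/
theorem exists_isWordIn_fourTransvections_left (B : Matrix.SpecialLinearGroup (Fin 2) ℤ) :
    ∃ φ : (hyperbolicForm.prod hyperbolicForm).IsometryEquiv (hyperbolicForm.prod hyperbolicForm),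
      IsWordIn {transvectionAEquiv isSymm_hyperbolicForm (Pi.single 0 1) 0 hyperbolicPlane_apply_e₀_e₀,
        transvectionAEquiv isSymm_hyperbolicForm (Pi.single 1 1) 0 hyperbolicPlane_apply_e₁_e₁,
        transvectionA'Equiv isSymm_hyperbolicForm (Pi.single 0 1) 0 hyperbolicPlane_apply_e₀_e₀,
        transvectionA'Equiv isSymm_hyperbolicForm (Pi.single 1 1) 0 hyperbolicPlane_apply_e₁_e₁} φ ∧
      ∀ v : (Fin 2 → ℤ) × (Fin 2 → ℤ), (!![(φ v).1 0, (φ v).2 0; (φ v).2 1, -((φ v).1 1)] : Matrix (Fin 2) (Fin 2) ℤ) =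
        (B : Matrix (Fin 2) (Fin 2) ℤ) * !![v.1 0, v.2 0; v.2 1, -(v.1 1)] := by
  -- the two generators `T = (1 1;0 1)` (`t(e,e₁)`) and `U = (1 0;−1 1)` (`t(f,f₁)`), and `S = T⁻¹ U⁻¹ T⁻¹`
  have hT : ∃ φ : (hyperbolicForm.prod hyperbolicForm).IsometryEquiv (hyperbolicForm.prod hyperbolicForm),
      IsWordIn {transvectionAEquiv isSymm_hyperbolicForm (Pi.single 0 1) 0 hyperbolicPlane_apply_e₀_e₀,
        transvectionAEquiv isSymm_hyperbolicForm (Pi.single 1 1) 0 hyperbolicPlane_apply_e₁_e₁,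
        transvectionA'Equiv isSymm_hyperbolicForm (Pi.single 0 1) 0 hyperbolicPlane_apply_e₀_e₀,
        transvectionA'Equiv isSymm_hyperbolicForm (Pi.single 1 1) 0 hyperbolicPlane_apply_e₁_e₁} φ ∧
      ∀ v : (Fin 2 → ℤ) × (Fin 2 → ℤ), (!![(φ v).1 0, (φ v).2 0; (φ v).2 1, -((φ v).1 1)] : Matrix (Fin 2) (Fin 2) ℤ) =
        (ModularGroup.T : Matrix (Fin 2) (Fin 2) ℤ) * !![v.1 0, v.2 0; v.2 1, -(v.1 1)] :=
    ⟨_, IsWordIn.of_mem (Or.inr (Or.inr (Or.inl rfl))), fun v ↦ by rw [ModularGroup.coe_T, ghsMatrix_transvectionA'Equiv_e₀]⟩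
  have hU : ∃ φ : (hyperbolicForm.prod hyperbolicForm).IsometryEquiv (hyperbolicForm.prod hyperbolicForm),
      IsWordIn {transvectionAEquiv isSymm_hyperbolicForm (Pi.single 0 1) 0 hyperbolicPlane_apply_e₀_e₀,
        transvectionAEquiv isSymm_hyperbolicForm (Pi.single 1 1) 0 hyperbolicPlane_apply_e₁_e₁,
        transvectionA'Equiv isSymm_hyperbolicForm (Pi.single 0 1) 0 hyperbolicPlane_apply_e₀_e₀,
        transvectionA'Equiv isSymm_hyperbolicForm (Pi.single 1 1) 0 hyperbolicPlane_apply_e₁_e₁} φ ∧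
      ∀ v : (Fin 2 → ℤ) × (Fin 2 → ℤ), (!![(φ v).1 0, (φ v).2 0; (φ v).2 1, -((φ v).1 1)] : Matrix (Fin 2) (Fin 2) ℤ) =
        ((⟨!![1, 0; -1, 1], by norm_num [Matrix.det_fin_two_of]⟩ : Matrix.SpecialLinearGroup (Fin 2) ℤ) :
          Matrix (Fin 2) (Fin 2) ℤ) * !![v.1 0, v.2 0; v.2 1, -(v.1 1)] :=
    ⟨_, IsWordIn.of_mem (Or.inr (Or.inl rfl)), fun v ↦ by rw [ghsMatrix_transvectionAEquiv_e₁]⟩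
  have hS : ∃ φ : (hyperbolicForm.prod hyperbolicForm).IsometryEquiv (hyperbolicForm.prod hyperbolicForm),
      IsWordIn {transvectionAEquiv isSymm_hyperbolicForm (Pi.single 0 1) 0 hyperbolicPlane_apply_e₀_e₀,
        transvectionAEquiv isSymm_hyperbolicForm (Pi.single 1 1) 0 hyperbolicPlane_apply_e₁_e₁,
        transvectionA'Equiv isSymm_hyperbolicForm (Pi.single 0 1) 0 hyperbolicPlane_apply_e₀_e₀,
        transvectionA'Equiv isSymm_hyperbolicForm (Pi.single 1 1) 0 hyperbolicPlane_apply_e₁_e₁} φ ∧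
      ∀ v : (Fin 2 → ℤ) × (Fin 2 → ℤ), (!![(φ v).1 0, (φ v).2 0; (φ v).2 1, -((φ v).1 1)] : Matrix (Fin 2) (Fin 2) ℤ) =
        (ModularGroup.S : Matrix (Fin 2) (Fin 2) ℤ) * !![v.1 0, v.2 0; v.2 1, -(v.1 1)] := by
    rw [modularGroup_S_eq_inv ⟨!![1, 0; -1, 1], by norm_num [Matrix.det_fin_two_of]⟩ rfl]
    exact exists_isWordIn_fourTransvections_left_mul
      (exists_isWordIn_fourTransvections_left_mul (exists_isWordIn_fourTransvections_left_inv hT)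
        (exists_isWordIn_fourTransvections_left_inv hU)) (exists_isWordIn_fourTransvections_left_inv hT)
  have hmem : B ∈ Subgroup.closure ({ModularGroup.S, ModularGroup.T} : Set (Matrix.SpecialLinearGroup (Fin 2) ℤ)) := by
    rw [SpecialLinearGroup.SL2Z_generators]
    exact Subgroup.mem_top B
  refine Subgroup.closure_induction (p := fun (B : Matrix.SpecialLinearGroup (Fin 2) ℤ) _ ↦
      ∃ φ : (hyperbolicForm.prod hyperbolicForm).IsometryEquiv (hyperbolicForm.prod hyperbolicForm),
      IsWordIn {transvectionAEquiv isSymm_hyperbolicForm (Pi.single 0 1) 0 hyperbolicPlane_apply_e₀_e₀,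
        transvectionAEquiv isSymm_hyperbolicForm (Pi.single 1 1) 0 hyperbolicPlane_apply_e₁_e₁,
        transvectionA'Equiv isSymm_hyperbolicForm (Pi.single 0 1) 0 hyperbolicPlane_apply_e₀_e₀,
        transvectionA'Equiv isSymm_hyperbolicForm (Pi.single 1 1) 0 hyperbolicPlane_apply_e₁_e₁} φ ∧
      ∀ v : (Fin 2 → ℤ) × (Fin 2 → ℤ), (!![(φ v).1 0, (φ v).2 0; (φ v).2 1, -((φ v).1 1)] : Matrix (Fin 2) (Fin 2) ℤ) =
        (B : Matrix (Fin 2) (Fin 2) ℤ) * !![v.1 0, v.2 0; v.2 1, -(v.1 1)])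
    (fun s hs ↦ ?_) ?_ (fun _ _ _ _ hx hy ↦ exists_isWordIn_fourTransvections_left_mul hx hy)
    (fun _ _ hx ↦ exists_isWordIn_fourTransvections_left_inv hx) hmem
  · rcases hs with rfl | rfl
    · exact hS
    · exact hT
  · exact ⟨_, IsWordIn.refl, fun v ↦ by
      rw [Matrix.SpecialLinearGroup.coe_one, one_mul, LinearMap.BilinForm.IsometryEquiv.refl_apply]⟩

/-- **The `A`-copy of `SL₂(ℤ)` is realised by words** (generated by `t(e,f₁) : X ↦ X(1 −1;0 1)` and
`t(f,e₁) : X ↦ X(1 0;1 1)`): for every `C ∈ SL₂(ℤ)` some word `φ` in the four transvections acts by `X ↦ XC`.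
[cite: GritsenkoHulekSankaran2009, §3.2 (14) ("the second by t(e,f₁) and t(f,e₁)")] -/
theorem exists_isWordIn_fourTransvections_right (C : Matrix.SpecialLinearGroup (Fin 2) ℤ) :
    ∃ φ : (hyperbolicForm.prod hyperbolicForm).IsometryEquiv (hyperbolicForm.prod hyperbolicForm),
      IsWordIn {transvectionAEquiv isSymm_hyperbolicForm (Pi.single 0 1) 0 hyperbolicPlane_apply_e₀_e₀,
        transvectionAEquiv isSymm_hyperbolicForm (Pi.single 1 1) 0 hyperbolicPlane_apply_e₁_e₁,
        transvectionA'Equiv isSymm_hyperbolicForm (Pi.single 0 1) 0 hyperbolicPlane_apply_e₀_e₀,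
        transvectionA'Equiv isSymm_hyperbolicForm (Pi.single 1 1) 0 hyperbolicPlane_apply_e₁_e₁} φ ∧
      ∀ v : (Fin 2 → ℤ) × (Fin 2 → ℤ), (!![(φ v).1 0, (φ v).2 0; (φ v).2 1, -((φ v).1 1)] : Matrix (Fin 2) (Fin 2) ℤ) =
        !![v.1 0, v.2 0; v.2 1, -(v.1 1)] * (C : Matrix (Fin 2) (Fin 2) ℤ) := by
  -- generators `T⁻¹ = (1 −1;0 1)` (`t(e,f₁)`) and `U⁺ = (1 0;1 1)` (`t(f,e₁)`), and `S = T⁻¹ U⁺ T⁻¹`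
  have hTi : ∃ φ : (hyperbolicForm.prod hyperbolicForm).IsometryEquiv (hyperbolicForm.prod hyperbolicForm),
      IsWordIn {transvectionAEquiv isSymm_hyperbolicForm (Pi.single 0 1) 0 hyperbolicPlane_apply_e₀_e₀,
        transvectionAEquiv isSymm_hyperbolicForm (Pi.single 1 1) 0 hyperbolicPlane_apply_e₁_e₁,
        transvectionA'Equiv isSymm_hyperbolicForm (Pi.single 0 1) 0 hyperbolicPlane_apply_e₀_e₀,
        transvectionA'Equiv isSymm_hyperbolicForm (Pi.single 1 1) 0 hyperbolicPlane_apply_e₁_e₁} φ ∧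
      ∀ v : (Fin 2 → ℤ) × (Fin 2 → ℤ), (!![(φ v).1 0, (φ v).2 0; (φ v).2 1, -((φ v).1 1)] : Matrix (Fin 2) (Fin 2) ℤ) =
        !![v.1 0, v.2 0; v.2 1, -(v.1 1)] * ((ModularGroup.T⁻¹ : Matrix.SpecialLinearGroup (Fin 2) ℤ) :
          Matrix (Fin 2) (Fin 2) ℤ) :=
    ⟨_, IsWordIn.of_mem (Or.inr (Or.inr (Or.inr rfl))), fun v ↦ by
      rw [ModularGroup.coe_T_inv, ghsMatrix_transvectionA'Equiv_e₁]⟩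
  have hU : ∃ φ : (hyperbolicForm.prod hyperbolicForm).IsometryEquiv (hyperbolicForm.prod hyperbolicForm),
      IsWordIn {transvectionAEquiv isSymm_hyperbolicForm (Pi.single 0 1) 0 hyperbolicPlane_apply_e₀_e₀,
        transvectionAEquiv isSymm_hyperbolicForm (Pi.single 1 1) 0 hyperbolicPlane_apply_e₁_e₁,
        transvectionA'Equiv isSymm_hyperbolicForm (Pi.single 0 1) 0 hyperbolicPlane_apply_e₀_e₀,
        transvectionA'Equiv isSymm_hyperbolicForm (Pi.single 1 1) 0 hyperbolicPlane_apply_e₁_e₁} φ ∧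
      ∀ v : (Fin 2 → ℤ) × (Fin 2 → ℤ), (!![(φ v).1 0, (φ v).2 0; (φ v).2 1, -((φ v).1 1)] : Matrix (Fin 2) (Fin 2) ℤ) =
        !![v.1 0, v.2 0; v.2 1, -(v.1 1)] * ((⟨!![1, 0; 1, 1], by norm_num [Matrix.det_fin_two_of]⟩ :
          Matrix.SpecialLinearGroup (Fin 2) ℤ) : Matrix (Fin 2) (Fin 2) ℤ) :=
    ⟨_, IsWordIn.of_mem (Or.inl rfl), fun v ↦ by rw [ghsMatrix_transvectionAEquiv_e₀]⟩
  have hS : ∃ φ : (hyperbolicForm.prod hyperbolicForm).IsometryEquiv (hyperbolicForm.prod hyperbolicForm),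
      IsWordIn {transvectionAEquiv isSymm_hyperbolicForm (Pi.single 0 1) 0 hyperbolicPlane_apply_e₀_e₀,
        transvectionAEquiv isSymm_hyperbolicForm (Pi.single 1 1) 0 hyperbolicPlane_apply_e₁_e₁,
        transvectionA'Equiv isSymm_hyperbolicForm (Pi.single 0 1) 0 hyperbolicPlane_apply_e₀_e₀,
        transvectionA'Equiv isSymm_hyperbolicForm (Pi.single 1 1) 0 hyperbolicPlane_apply_e₁_e₁} φ ∧
      ∀ v : (Fin 2 → ℤ) × (Fin 2 → ℤ), (!![(φ v).1 0, (φ v).2 0; (φ v).2 1, -((φ v).1 1)] : Matrix (Fin 2) (Fin 2) ℤ) =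
        !![v.1 0, v.2 0; v.2 1, -(v.1 1)] * (ModularGroup.S : Matrix (Fin 2) (Fin 2) ℤ) := by
    rw [modularGroup_S_eq]
    exact exists_isWordIn_fourTransvections_right_mul (exists_isWordIn_fourTransvections_right_mul hTi hU) hTi
  have hT : ∃ φ : (hyperbolicForm.prod hyperbolicForm).IsometryEquiv (hyperbolicForm.prod hyperbolicForm),
      IsWordIn {transvectionAEquiv isSymm_hyperbolicForm (Pi.single 0 1) 0 hyperbolicPlane_apply_e₀_e₀,
        transvectionAEquiv isSymm_hyperbolicForm (Pi.single 1 1) 0 hyperbolicPlane_apply_e₁_e₁,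
        transvectionA'Equiv isSymm_hyperbolicForm (Pi.single 0 1) 0 hyperbolicPlane_apply_e₀_e₀,
        transvectionA'Equiv isSymm_hyperbolicForm (Pi.single 1 1) 0 hyperbolicPlane_apply_e₁_e₁} φ ∧
      ∀ v : (Fin 2 → ℤ) × (Fin 2 → ℤ), (!![(φ v).1 0, (φ v).2 0; (φ v).2 1, -((φ v).1 1)] : Matrix (Fin 2) (Fin 2) ℤ) =
        !![v.1 0, v.2 0; v.2 1, -(v.1 1)] * (ModularGroup.T : Matrix (Fin 2) (Fin 2) ℤ) := by
    simpa only [inv_inv] using exists_isWordIn_fourTransvections_right_inv hTi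
  have hmem : C ∈ Subgroup.closure ({ModularGroup.S, ModularGroup.T} : Set (Matrix.SpecialLinearGroup (Fin 2) ℤ)) := by
    rw [SpecialLinearGroup.SL2Z_generators]
    exact Subgroup.mem_top C
  refine Subgroup.closure_induction (p := fun (C : Matrix.SpecialLinearGroup (Fin 2) ℤ) _ ↦
      ∃ φ : (hyperbolicForm.prod hyperbolicForm).IsometryEquiv (hyperbolicForm.prod hyperbolicForm),
      IsWordIn {transvectionAEquiv isSymm_hyperbolicForm (Pi.single 0 1) 0 hyperbolicPlane_apply_e₀_e₀,
        transvectionAEquiv isSymm_hyperbolicForm (Pi.single 1 1) 0 hyperbolicPlane_apply_e₁_e₁,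
        transvectionA'Equiv isSymm_hyperbolicForm (Pi.single 0 1) 0 hyperbolicPlane_apply_e₀_e₀,
        transvectionA'Equiv isSymm_hyperbolicForm (Pi.single 1 1) 0 hyperbolicPlane_apply_e₁_e₁} φ ∧
      ∀ v : (Fin 2 → ℤ) × (Fin 2 → ℤ), (!![(φ v).1 0, (φ v).2 0; (φ v).2 1, -((φ v).1 1)] : Matrix (Fin 2) (Fin 2) ℤ) =
        !![v.1 0, v.2 0; v.2 1, -(v.1 1)] * (C : Matrix (Fin 2) (Fin 2) ℤ))
    (fun s hs ↦ ?_) ?_ (fun _ _ _ _ hx hy ↦ exists_isWordIn_fourTransvections_right_mul hx hy)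
    (fun _ _ hx ↦ exists_isWordIn_fourTransvections_right_inv hx) hmem
  · rcases hs with rfl | rfl
    · exact hS
    · exact hT
  · exact ⟨_, IsWordIn.refl, fun v ↦ by
      rw [Matrix.SpecialLinearGroup.coe_one, mul_one, LinearMap.BilinForm.IsometryEquiv.refl_apply]⟩

/-- **(14) is defined on all of `SL₂(ℤ) × SL₂(ℤ)`**: for all `B, A ∈ SL₂(ℤ)` some word in the four transvections acts
by `X ↦ B X A⁻¹`. [cite: GritsenkoHulekSankaran2009, §3.2 (14)] -/
theorem exists_isWordIn_fourTransvections_sl2 (B A : Matrix.SpecialLinearGroup (Fin 2) ℤ) :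
    ∃ φ : (hyperbolicForm.prod hyperbolicForm).IsometryEquiv (hyperbolicForm.prod hyperbolicForm),
      IsWordIn {transvectionAEquiv isSymm_hyperbolicForm (Pi.single 0 1) 0 hyperbolicPlane_apply_e₀_e₀,
        transvectionAEquiv isSymm_hyperbolicForm (Pi.single 1 1) 0 hyperbolicPlane_apply_e₁_e₁,
        transvectionA'Equiv isSymm_hyperbolicForm (Pi.single 0 1) 0 hyperbolicPlane_apply_e₀_e₀,
        transvectionA'Equiv isSymm_hyperbolicForm (Pi.single 1 1) 0 hyperbolicPlane_apply_e₁_e₁} φ ∧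
      ∀ v : (Fin 2 → ℤ) × (Fin 2 → ℤ), (!![(φ v).1 0, (φ v).2 0; (φ v).2 1, -((φ v).1 1)] : Matrix (Fin 2) (Fin 2) ℤ) =
        (B : Matrix (Fin 2) (Fin 2) ℤ) * !![v.1 0, v.2 0; v.2 1, -(v.1 1)] *
          ((A⁻¹ : Matrix.SpecialLinearGroup (Fin 2) ℤ) : Matrix (Fin 2) (Fin 2) ℤ) := by
  obtain ⟨φ, hφw, hφ⟩ := exists_isWordIn_fourTransvections_left B
  obtain ⟨χ, hχw, hχ⟩ := exists_isWordIn_fourTransvections_right A⁻¹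
  exact ⟨φ.trans χ, hφw.trans hχw, fun v ↦ by rw [LinearMap.BilinForm.IsometryEquiv.trans_apply, hχ, hφ]⟩

/-- **(14) takes values in `SO⁺(U ⊕ U₁)`**: for all `B, A ∈ SL₂(ℤ)` there is `φ ∈ SO⁺(U ⊕ U₁)` acting by
`X ↦ B X A⁻¹`. [cite: GritsenkoHulekSankaran2009, §3.2 (14) ("SL₂(ℤ) × SL₂(ℤ)/{±(1₂,1₂)} ≅ SO⁺(U ⊕ U₁)")] -/
theorem exists_specialOrthogonal_sl2 (B A : Matrix.SpecialLinearGroup (Fin 2) ℤ) :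
    ∃ φ : (hyperbolicForm.prod hyperbolicForm).IsometryEquiv (hyperbolicForm.prod hyperbolicForm),
      (φ.IsOrientationPreserving ∧
        LinearMap.det (φ : (Fin 2 → ℤ) × (Fin 2 → ℤ) →ₗ[ℤ] (Fin 2 → ℤ) × (Fin 2 → ℤ)) = 1) ∧
      ∀ v : (Fin 2 → ℤ) × (Fin 2 → ℤ), (!![(φ v).1 0, (φ v).2 0; (φ v).2 1, -((φ v).1 1)] : Matrix (Fin 2) (Fin 2) ℤ) =
        (B : Matrix (Fin 2) (Fin 2) ℤ) * !![v.1 0, v.2 0; v.2 1, -(v.1 1)] *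
          ((A⁻¹ : Matrix.SpecialLinearGroup (Fin 2) ℤ) : Matrix (Fin 2) (Fin 2) ℤ) := by
  obtain ⟨φ, hφw, hφ⟩ := exists_isWordIn_fourTransvections_sl2 B A
  exact ⟨φ, (isWordIn_fourTransvections_iff φ).1 hφw, hφ⟩

/-- **(14) is a bijection onto `SO⁺` up to the relation**: `φ ∈ SO⁺(U ⊕ U₁)` iff `φ` acts by `X ↦ B X A⁻¹` for some
`B, A ∈ SL₂(ℤ)` (an isometry is determined by its action on `X`). [cite: GritsenkoHulekSankaran2009, §3.2 (14) and Lemma 3.2] -/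
theorem isOrientationPreserving_and_det_eq_one_iff_exists_sl2
    (φ : (hyperbolicForm.prod hyperbolicForm).IsometryEquiv (hyperbolicForm.prod hyperbolicForm)) :
    (φ.IsOrientationPreserving ∧
        LinearMap.det (φ : (Fin 2 → ℤ) × (Fin 2 → ℤ) →ₗ[ℤ] (Fin 2 → ℤ) × (Fin 2 → ℤ)) = 1) ↔
      ∃ B A : Matrix.SpecialLinearGroup (Fin 2) ℤ, ∀ v : (Fin 2 → ℤ) × (Fin 2 → ℤ),
        (!![(φ v).1 0, (φ v).2 0; (φ v).2 1, -((φ v).1 1)] : Matrix (Fin 2) (Fin 2) ℤ) =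
          (B : Matrix (Fin 2) (Fin 2) ℤ) * !![v.1 0, v.2 0; v.2 1, -(v.1 1)] *
            ((A⁻¹ : Matrix.SpecialLinearGroup (Fin 2) ℤ) : Matrix (Fin 2) (Fin 2) ℤ) := by
  refine ⟨fun h ↦ exists_sl2_eq_of_isOrientationPreserving_of_det_eq_one φ h.1 h.2, fun ⟨B, A, h⟩ ↦ ?_⟩
  obtain ⟨ψ, hψ, hψv⟩ := exists_specialOrthogonal_sl2 B A
  have hφψ : φ = ψ := DFunLike.ext _ _ fun v ↦ eq_of_ghsMatrix_eq (by rw [h, hψv])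
  rw [hφψ]
  exact hψ

end Realisation

/-! ### §5 The kernel of (14) is `±(1₂, 1₂)` -/

section Kernel

/-- **The kernel of `(B,A) ↦ (X ↦ BXA⁻¹)` is the centre `±(1₂,1₂)`**: if `B X(v) A⁻¹ = X(v)` for all `v ∈ U ⊕ U₁` then
`(B, A) = (1,1)` or `(−1,−1)`. [cite: GritsenkoHulekSankaran2009, §3.2 (14) ("Its kernel is the centre ±(1₂,1₂) of SL₂(ℤ) × SL₂(ℤ)")] -/
theorem sl2_eq_one_or_eq_neg_one_of_forall_eq (B A : Matrix.SpecialLinearGroup (Fin 2) ℤ)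
    (h : ∀ v : (Fin 2 → ℤ) × (Fin 2 → ℤ),
      (B : Matrix (Fin 2) (Fin 2) ℤ) * !![v.1 0, v.2 0; v.2 1, -(v.1 1)] *
          ((A⁻¹ : Matrix.SpecialLinearGroup (Fin 2) ℤ) : Matrix (Fin 2) (Fin 2) ℤ) =
        !![v.1 0, v.2 0; v.2 1, -(v.1 1)]) :
    ((B : Matrix (Fin 2) (Fin 2) ℤ) = 1 ∧ (A : Matrix (Fin 2) (Fin 2) ℤ) = 1) ∨
      ((B : Matrix (Fin 2) (Fin 2) ℤ) = -1 ∧ (A : Matrix (Fin 2) (Fin 2) ℤ) = -1) := by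
  have key : ∀ M : Matrix (Fin 2) (Fin 2) ℤ, (B : Matrix (Fin 2) (Fin 2) ℤ) * M *
      ((A⁻¹ : Matrix.SpecialLinearGroup (Fin 2) ℤ) : Matrix (Fin 2) (Fin 2) ℤ) = M := fun M ↦ by
    obtain ⟨v, rfl⟩ := exists_ghsMatrix_eq M
    exact h v
  -- `B A⁻¹ = 1`, so `A⁻¹ B = 1` and `B` commutes with every matrix
  have hBC : (B : Matrix (Fin 2) (Fin 2) ℤ) * ((A⁻¹ : Matrix.SpecialLinearGroup (Fin 2) ℤ) : Matrix (Fin 2) (Fin 2) ℤ) = 1 := by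
    simpa using key 1
  have hCB := mul_eq_one_comm.1 hBC
  have comm : ∀ M : Matrix (Fin 2) (Fin 2) ℤ, (B : Matrix (Fin 2) (Fin 2) ℤ) * M = M * (B : Matrix (Fin 2) (Fin 2) ℤ) := by
    intro M
    calc (B : Matrix (Fin 2) (Fin 2) ℤ) * M
        = (B : Matrix (Fin 2) (Fin 2) ℤ) * M * (((A⁻¹ : Matrix.SpecialLinearGroup (Fin 2) ℤ) : Matrix (Fin 2) (Fin 2) ℤ) *
            (B : Matrix (Fin 2) (Fin 2) ℤ)) := by rw [hCB, mul_one]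
      _ = ((B : Matrix (Fin 2) (Fin 2) ℤ) * M * ((A⁻¹ : Matrix.SpecialLinearGroup (Fin 2) ℤ) : Matrix (Fin 2) (Fin 2) ℤ)) *
            (B : Matrix (Fin 2) (Fin 2) ℤ) := by simp only [Matrix.mul_assoc]
      _ = M * (B : Matrix (Fin 2) (Fin 2) ℤ) := by rw [key]
  -- hence `B` is scalar: `B = b·1` with `b² = 1`
  have hB := Matrix.eta_fin_two (B : Matrix (Fin 2) (Fin 2) ℤ)
  have h₁ := comm !![1, 0; 0, 0]
  have h₂ := comm !![0, 1; 0, 0]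
  rw [hB, Matrix.mul_fin_two, Matrix.mul_fin_two] at h₁ h₂
  have e10 : (B : Matrix (Fin 2) (Fin 2) ℤ) 1 0 = 0 := by simpa using (congrFun (congrFun h₁ 1) 0)
  have e01 : (B : Matrix (Fin 2) (Fin 2) ℤ) 0 1 = 0 := by simpa using (congrFun (congrFun h₁ 0) 1).symm
  have e11 : (B : Matrix (Fin 2) (Fin 2) ℤ) 0 0 = (B : Matrix (Fin 2) (Fin 2) ℤ) 1 1 := by
    simpa using (congrFun (congrFun h₂ 0) 1)
  have hdet := Matrix.SpecialLinearGroup.det_coe B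
  rw [hB, Matrix.det_fin_two_of, e10, e01, ← e11, mul_zero, sub_zero] at hdet
  have hBs : (B : Matrix (Fin 2) (Fin 2) ℤ) = (B : Matrix (Fin 2) (Fin 2) ℤ) 0 0 • (1 : Matrix (Fin 2) (Fin 2) ℤ) := by
    rw [hB, Matrix.one_fin_two, Matrix.smul_of, e10, e01, ← e11]
    simp
  -- and `A = A⁻¹⁻¹ = b·1` as well
  have hA1 : (A : Matrix (Fin 2) (Fin 2) ℤ) * ((A⁻¹ : Matrix.SpecialLinearGroup (Fin 2) ℤ) : Matrix (Fin 2) (Fin 2) ℤ) = 1 := by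
    rw [← Matrix.SpecialLinearGroup.coe_mul, mul_inv_cancel, Matrix.SpecialLinearGroup.coe_one]
  have hAB : (A : Matrix (Fin 2) (Fin 2) ℤ) = (B : Matrix (Fin 2) (Fin 2) ℤ) := by
    calc (A : Matrix (Fin 2) (Fin 2) ℤ)
        = (A : Matrix (Fin 2) (Fin 2) ℤ) * (((A⁻¹ : Matrix.SpecialLinearGroup (Fin 2) ℤ) : Matrix (Fin 2) (Fin 2) ℤ) *
            (B : Matrix (Fin 2) (Fin 2) ℤ)) := by rw [hCB, mul_one]
      _ = (B : Matrix (Fin 2) (Fin 2) ℤ) := by rw [← Matrix.mul_assoc, hA1, one_mul]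
  rcases Int.eq_one_or_neg_one_of_mul_eq_one hdet with hb | hb
  · left
    rw [hAB, and_self, hBs, hb, one_smul]
  · right
    rw [hAB, and_self, hBs, hb, neg_one_smul]

end Kernel

end Literature.Topology.FourManifolds

end
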